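import Mathlib
import Summits.Ventures.PercRepro2.Defs
import Summits.Ventures.PercRepro2.Graph
import Summits.Ventures.PercRepro2.Events
import Summits.Ventures.PercRepro2.Harris
import Summits.Ventures.PercRepro2.Induced
import Summits.Ventures.PercRepro2.BHKEvents
import Summits.Ventures.PercRepro2.XWForm

/-!
# The cross W-form as the expectation of a single-cluster functional (PercRepro2, p2 g25)

Explore the cluster `K = C_s` of `s`.  On `{y ∈ K}` (the event `S = {s ↔ y}`) the events `a`, `λ`
are `u ∈ K`, `o ∈ K`; on `{y ∉ K}` (`Q`) the event `a` is `u ∈ K` and `λ = {y ↔ o}` has conditional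
probability `g(K) = P(y ↔ o in G ∖ K)` (`delClusterProb`, the cell's tower identity
`prob_clusterIn_inter_eq_expect`).  Writing `Q = P(Q)`, `Qa = P(Q ∩ a)`, `Qλ = P(Q ∩ λ)`, the slack
of (XW) is the expectation of the **single-cluster functional**

  `ψ(K) = Q · 1_{y∈K} · (Q·1_{u∈K} − Qa) · (Q·1_{o∈K} − Qλ) + 1_{y∉K} · (Q·1_{u∈K} − Qa) · (Q·g(K) − Qλ)`,

namely **`P(Q)² · XW = E[ψ(C_s)]`** (`xwBil_eq_expect_clusterFunctional`, division-free).  In words: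
on the `S`-clusters the functional is the product of the `Q`-centred indicators of `u` and `o`, on the
`Q`-clusters it is the `Q`-centred indicator of `u` times the `Q`-centred outside connection
probability of `y` and `o` — the exploration-process form of (XW), whose `Q`-part sums to
`P(Q)²·Cov_Q(a, λ) ≤ 0` (BHK) and whose `S`-part must pay for it.  Own work (record
proofs/P2-G25-XWSTRUCT.md §5); standard axioms.
-/

namespace Summit.Ventures.PercRepro2

namespace XWCluster

variable {V : Type*} {E : Type*} [Fintype E] [DecidableEq E] [Fintype V] [DecidableEq V]
  {R : Type*} [CommRing R] [LinearOrder R] [IsStrictOrderedRing R]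

omit [Fintype V] [DecidableEq V] [LinearOrder R] [IsStrictOrderedRing R] in
/-- `g(K) = P(y ↔ o in G ∖ K)`: the outside connection probability of `y` and `o`. -/
noncomputable def gOut (p : E → R) (ends : E → Sym2 V) (y o : V) (K : Set V) : R :=
  delClusterProb p ends y {W : Set V | o ∈ W} K

omit [Fintype V] [DecidableEq V] [LinearOrder R] [IsStrictOrderedRing R] in
/-- **The single-cluster functional** `ψ` evaluated at the cluster of `s` in `ω`. -/
noncomputable def clusterFunctional (p : E → R) (ends : E → Sym2 V) (s y o u : V)
    (ω : Config E) : R :=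
  prob p (connEvent ends s y)ᶜ * (connEvent ends s y).indicator 1 ω *
      (prob p (connEvent ends s y)ᶜ * (connEvent ends s u).indicator 1 ω -
        prob p (connEvent ends s u ∩ (connEvent ends s y)ᶜ)) *
      (prob p (connEvent ends s y)ᶜ * (connEvent ends s o).indicator 1 ω -
        prob p (connEvent ends y o ∩ (connEvent ends s y)ᶜ)) +
    ((connEvent ends s y)ᶜ).indicator 1 ω *
      (prob p (connEvent ends s y)ᶜ * (connEvent ends s u).indicator 1 ω -
        prob p (connEvent ends s u ∩ (connEvent ends s y)ᶜ)) *
      (prob p (connEvent ends s y)ᶜ * gOut p ends y o (cluster ends ω s) -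
        prob p (connEvent ends y o ∩ (connEvent ends s y)ᶜ))

omit [Fintype E] [DecidableEq E] [Fintype V] [DecidableEq V] [LinearOrder R] [IsStrictOrderedRing R] in
/-- `{C_s ∋ x}` is the connection event `{s ↔ x}`. -/
lemma clusterInEvent_mem_eq (ends : E → Sym2 V) (s x : V) :
    clusterInEvent ends s {W : Set V | x ∈ W} = connEvent ends s x := by
  ext ω; simp [clusterInEvent, cluster, connEvent]

omit [Fintype E] [DecidableEq E] [Fintype V] [DecidableEq V] [LinearOrder R] [IsStrictOrderedRing R] in
/-- The indicator of `{x ∈ ·}` at `C_s(ω)` is the indicator of `{s ↔ x}` at `ω`. -/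
lemma indicator_mem_cluster (ends : E → Sym2 V) (s x : V) (ω : Config E) :
    ({W : Set V | x ∈ W} : Set (Set V)).indicator (1 : Set V → R) (cluster ends ω s) =
      (connEvent ends s x).indicator (1 : Config E → R) ω := by
  classical
  by_cases h : Conn ends ω s x
  · have h1 : cluster ends ω s ∈ {W : Set V | x ∈ W} := h
    have h2 : ω ∈ connEvent ends s x := h
    simp [Set.indicator_of_mem h1, Set.indicator_of_mem h2]
  · have h1 : cluster ends ω s ∉ {W : Set V | x ∈ W} := h
    have h2 : ω ∉ connEvent ends s x := h
    simp [Set.indicator_of_notMem h1, Set.indicator_of_notMem h2]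

omit [Fintype E] [DecidableEq E] [Fintype V] [DecidableEq V] [LinearOrder R] [IsStrictOrderedRing R] in
/-- Products of indicators are indicators of intersections. -/
lemma indicator_mul_indicator (A B : Set (Config E)) (ω : Config E) :
    A.indicator (1 : Config E → R) ω * B.indicator (1 : Config E → R) ω =
      (A ∩ B).indicator (1 : Config E → R) ω := by
  classical
  by_cases hA : ω ∈ A <;> by_cases hB : ω ∈ B <;> simp [hA, hB]

omit [DecidableEq V] [LinearOrder R] [IsStrictOrderedRing R] in
/-- **`P(Q ∩ a ∩ λ) = E[1_{u∈K} · g(K) · 1_{y∉K}]`** (the tower identity in the (XW) vocabulary). -/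
lemma prob_Q_a_l_eq_expect (p : E → R) (ends : E → Sym2 V) (s y o u : V) :
    prob p (connEvent ends s u ∩ connEvent ends y o ∩ (connEvent ends s y)ᶜ) =
      expect p (fun ω => (connEvent ends s u).indicator 1 ω *
        gOut p ends y o (cluster ends ω s) * ((connEvent ends s y)ᶜ).indicator 1 ω) := by
  have h := prob_clusterIn_inter_eq_expect p ends s y {W : Set V | u ∈ W} {W : Set V | o ∈ W}
  rw [clusterInEvent_mem_eq, clusterInEvent_mem_eq] at h
  rw [h]
  unfold expect
  refine Finset.sum_congr rfl fun ω _ => ?_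
  simp only [indicator_mem_cluster, gOut]

omit [DecidableEq V] [LinearOrder R] [IsStrictOrderedRing R] in
/-- **`P(Q ∩ λ) = E[g(K) · 1_{y∉K}]`**. -/
lemma prob_Q_l_eq_expect (p : E → R) (ends : E → Sym2 V) (s y o : V) :
    prob p (connEvent ends y o ∩ (connEvent ends s y)ᶜ) =
      expect p (fun ω => gOut p ends y o (cluster ends ω s) *
        ((connEvent ends s y)ᶜ).indicator 1 ω) := by
  have h := prob_clusterIn_inter_eq_expect p ends s y Set.univ {W : Set V | o ∈ W}
  rw [clusterInEvent_mem_eq] at h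
  simp only [clusterInEvent, Set.mem_univ, Set.setOf_true, Set.univ_inter, Set.indicator_univ,
    Pi.one_apply, one_mul] at h
  rw [h]
  unfold expect
  refine Finset.sum_congr rfl fun ω _ => ?_
  simp only [gOut]

omit [DecidableEq V] [LinearOrder R] [IsStrictOrderedRing R] in
/-- **The single-cluster form of (XW)**: `P(Q)² · XW = E[ψ(C_s)]`. -/
theorem xwBil_eq_expect_clusterFunctional (p : E → R) (ends : E → Sym2 V) (s y o u : V) :
    prob p (connEvent ends s y)ᶜ ^ 2 * xwBil ends s y o u p p =
      expect p (clusterFunctional p ends s y o u) := by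
  classical
  have hso3 : connEvent ends s y ∩ connEvent ends s u ∩ connEvent ends s o =
      connEvent ends s y ∩ connEvent ends s u ∩ connEvent ends y o := by
    rw [Set.inter_right_comm, connEvent_sy_inter_so_xw, Set.inter_right_comm]
  have hso2 : connEvent ends s y ∩ connEvent ends s o =
      connEvent ends s y ∩ connEvent ends y o := connEvent_sy_inter_so_xw ends s y o
  set S := connEvent ends s y with hS
  set a := connEvent ends s u with ha
  set l := connEvent ends y o with hl
  set so := connEvent ends s o with hso
  set Q := prob p Sᶜ with hQ
  set Qa := prob p (a ∩ Sᶜ) with hQa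
  set Ql := prob p (l ∩ Sᶜ) with hQl
  -- the eight expectations
  have e1 : expect p (fun ω => S.indicator 1 ω * a.indicator 1 ω * so.indicator 1 ω) =
      prob p (S ∩ a ∩ l) := by
    rw [prob_eq_expect_indicator]
    unfold expect
    refine Finset.sum_congr rfl fun ω _ => ?_
    simp only [indicator_mul_indicator, hso3]
  have e2 : expect p (fun ω => S.indicator 1 ω * a.indicator 1 ω) = prob p (S ∩ a) := by
    rw [prob_eq_expect_indicator]
    unfold expect
    refine Finset.sum_congr rfl fun ω _ => ?_
    simp only [indicator_mul_indicator]
  have e3 : expect p (fun ω => S.indicator 1 ω * so.indicator 1 ω) = prob p (S ∩ l) := by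
    rw [prob_eq_expect_indicator]
    unfold expect
    refine Finset.sum_congr rfl fun ω _ => ?_
    simp only [indicator_mul_indicator, hso2]
  have e4 : expect p (fun ω => S.indicator 1 ω) = prob p S := by
    rw [prob_eq_expect_indicator]
  have e5 : expect p (fun ω => a.indicator 1 ω * gOut p ends y o (cluster ends ω s) *
      Sᶜ.indicator 1 ω) = prob p (a ∩ l ∩ Sᶜ) := (prob_Q_a_l_eq_expect p ends s y o u).symm
  have e6 : expect p (fun ω => Sᶜ.indicator 1 ω * a.indicator 1 ω) = Qa := by
    rw [hQa, prob_eq_expect_indicator]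
    unfold expect
    refine Finset.sum_congr rfl fun ω _ => ?_
    simp only [indicator_mul_indicator, Set.inter_comm]
  have e7 : expect p (fun ω => gOut p ends y o (cluster ends ω s) * Sᶜ.indicator 1 ω) = Ql :=
    (prob_Q_l_eq_expect p ends s y o).symm
  have e8 : expect p (fun ω => Sᶜ.indicator 1 ω) = Q := by
    rw [hQ, prob_eq_expect_indicator]
  -- expand the functional by linearity
  have hexp : clusterFunctional p ends s y o u =
      (fun ω => (Q ^ 3) * (S.indicator 1 ω * a.indicator 1 ω * so.indicator 1 ω)) +
      (fun ω => (-(Q ^ 2 * Ql)) * (S.indicator 1 ω * a.indicator 1 ω)) +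
      (fun ω => (-(Q ^ 2 * Qa)) * (S.indicator 1 ω * so.indicator 1 ω)) +
      (fun ω => (Q * Qa * Ql) * S.indicator 1 ω) +
      (fun ω => (Q ^ 2) * (a.indicator 1 ω * gOut p ends y o (cluster ends ω s) *
        Sᶜ.indicator 1 ω)) +
      (fun ω => (-(Q * Ql)) * (Sᶜ.indicator 1 ω * a.indicator 1 ω)) +
      (fun ω => (-(Q * Qa)) * (gOut p ends y o (cluster ends ω s) * Sᶜ.indicator 1 ω)) +
      (fun ω => (Qa * Ql) * Sᶜ.indicator 1 ω) := by
    funext ω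
    simp only [clusterFunctional, Pi.add_apply]
    ring
  rw [hexp, expect_add, expect_add, expect_add, expect_add, expect_add, expect_add, expect_add,
    expect_const_mul, expect_const_mul, expect_const_mul, expect_const_mul, expect_const_mul,
    expect_const_mul, expect_const_mul, expect_const_mul, e1, e2, e3, e4, e5, e6, e7, e8]
  -- the seven probabilities of `xwBil` in terms of the cells
  unfold xwBil
  have f1 : prob p (a ∩ l) = prob p (a ∩ l ∩ S) + prob p (a ∩ l ∩ Sᶜ) :=
    (prob_inter_add_prob_inter_compl p (a ∩ l) S).symm
  have f2 : prob p a = prob p (a ∩ S) + prob p (a ∩ Sᶜ) :=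
    (prob_inter_add_prob_inter_compl p a S).symm
  have f3 : prob p l = prob p (l ∩ S) + prob p (l ∩ Sᶜ) :=
    (prob_inter_add_prob_inter_compl p l S).symm
  have f4 : prob p Sᶜ = 1 - prob p S := prob_compl p S
  have g1 : a ∩ l ∩ S = S ∩ a ∩ l := by ext x; simp only [Set.mem_inter_iff]; tauto
  have g2 : a ∩ S = S ∩ a := Set.inter_comm _ _
  have g3 : l ∩ S = S ∩ l := Set.inter_comm _ _
  rw [f1, f2, f3, g1, g2, g3, hQ, hQa, hQl, f4]
  ring

omit [DecidableEq V] in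
/-- **(XW) ⟺ `E[ψ(C_s)] ≥ 0`** when `P(Q) > 0`: the slack of (XW) has the sign of the
expectation of the single-cluster functional. -/
theorem xwBil_nonneg_iff_expect_clusterFunctional_nonneg (p : E → R) (ends : E → Sym2 V)
    (s y o u : V) (hQ : 0 < prob p (connEvent ends s y)ᶜ) :
    0 ≤ xwBil ends s y o u p p ↔ 0 ≤ expect p (clusterFunctional p ends s y o u) := by
  rw [← xwBil_eq_expect_clusterFunctional]
  have h2 : 0 < prob p (connEvent ends s y)ᶜ ^ 2 := by positivity
  constructor
  · intro h
    exact mul_nonneg h2.le h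
  · intro h
    exact le_of_mul_le_mul_left (by rw [mul_zero]; exact h) h2

end XWCluster

end Summit.Ventures.PercRepro2
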